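import Summits.RiemannHypothesis.RiemannHypothesis.Theorems.SignConePointwiseCertThreeHalvesData
import Summits.RiemannHypothesis.RiemannHypothesis.Theorems.SignConeCondRungSOSFiftyFiveData

/-!
# Route SignCone: pointwise certificate `pwCert32` (b = 3/2) — SOS tail bound in kernel chunks (B)

Support for the unconditional rung `a ≤ 3/2` (items stmt-RiemannHypothesis-16302 / 16301). The tail clause of the corrected
checker needs `sosBound` of the Dirichlet-SOS certificate `pwCert32sos` (basis `1..90`, rank `62`): too large for one kernel
evaluation, so it is bounded row-chunk by row-chunk (`SOSData.sosBound_eq_sumR`, `sumR_add'`, `decide +kernel`), and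
`pwCert32_tailH` is then DERIVED (file `…ThreeHalvesTail`).
-/

noncomputable section

-- `Summit.RiemannHypothesis.RiemannHypothesis.…` repeats a namespace component by design (D-0017 layout).
set_option linter.dupNamespace false

open Literature.Analysis.ValidatedNumerics.Numerics Literature.NumberTheory.LFunctions

namespace Summit.RiemannHypothesis.RiemannHypothesis.Theorems.SignCone

set_option maxHeartbeats 0 in
/-- Row chunk `p' ∈ [15, 20)` of `pwCert32sos.sosBound`. [folklore] -/
theorem pwCert32_sosChunk5 :
    (sumR 5 fun i => pwCert32sos.sosInner pwCert32.nodeList pwCert32.a (15 + i)) ≤ (931/10000000) := by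
  decide +kernel

set_option maxHeartbeats 0 in
/-- Row chunk `p' ∈ [20, 28)` of `pwCert32sos.sosBound`. [folklore] -/
theorem pwCert32_sosChunk6 :
    (sumR 8 fun i => pwCert32sos.sosInner pwCert32.nodeList pwCert32.a (20 + i)) ≤ (7/78125) := by
  decide +kernel

set_option maxHeartbeats 0 in
/-- Row chunk `p' ∈ [28, 36)` of `pwCert32sos.sosBound`. [folklore] -/
theorem pwCert32_sosChunk7 :
    (sumR 8 fun i => pwCert32sos.sosInner pwCert32.nodeList pwCert32.a (28 + i)) ≤ (519/10000000) := by
  decide +kernel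

set_option maxHeartbeats 0 in
/-- Row chunk `p' ∈ [36, 45)` of `pwCert32sos.sosBound`. [folklore] -/
theorem pwCert32_sosChunk8 :
    (sumR 9 fun i => pwCert32sos.sosInner pwCert32.nodeList pwCert32.a (36 + i)) ≤ (603/10000000) := by
  decide +kernel

end Summit.RiemannHypothesis.RiemannHypothesis.Theorems.SignCone

end
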